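import Literature.Combinatorics.SimpleGraph.LittleTheoremProofs
import Literature.Combinatorics.SimpleGraph.MatchingMinorPfaffian
import Literature.Combinatorics.SimpleGraph.MatchingMinorIsomorphism
import Mathlib.Logic.Equiv.Fintype
import HarnessLib

/-!
# Route PolyaContinued — support item `SignedCoverLittle` (stmt-ValiantsHypothesis-7426):
# the base case of the target reduction — a deletion-minimal non-Pfaffian target without
# degree-2 vertices is `K_{3,3} ⊔` a perfect matching

Step (SC5) of the E-side chain (`stub_chain` of the line `even_induction`; §1 (R) of the paper
proof `proof-LabelTransfer.md`). Little's theorem (tree: `Little1975_…_holds`) is used as a BLACK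
BOX: a non-Pfaffian `E ⊆ Fin n × Fin n` has a central subgraph `K` (rows/columns embedded by
`r, c`, complementary perfect matching `τ`) which `Bicontracts` to `K_{3,3}`.

* `eq_or_eq_of_erase_minimal` — if every one-edge-deleted subgraph of the non-Pfaffian `E` is
  Pfaffian, then `E` IS the padded central subgraph `(r × c)(K) ∪ graph τ` (that subgraph has the
  `K_{3,3}` matching minor, hence is non-Pfaffian);
* `card_filter_adj_inl/inr`, `card_filter_adj_equiv` — vertex degrees in the edge-set encoding and
  their invariance under isomorphisms of the abstract graphs; `exists_degree_two_of_bicontractionStep`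
  — a bicontraction step needs a vertex of degree two; `eq_univ_of_isIsomorphic_univ` — a graph on
  `Fin 3 × Fin 3` isomorphic to `K_{3,3}` is `K_{3,3}`;
* `exists_relabel_kstd` — `(r × c)(K_{3,3}) ∪ graph τ` is a relabelling `relabel (kstd n) ρ κ` of the
  STANDARD TARGET `kstd n = {(x, y) : x, y < 3} ∪ {(x, x) : 3 ≤ x}` (written as its defining filter,
  as in the line's skeleton);
* `exists_relabel_kstd_of_minimal` — **(SC5)**: a non-Pfaffian `E`, all of whose one-edge-deleted
  subgraphs are Pfaffian and none of whose rows or columns has exactly two cells, is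
  `relabel (kstd n) ρ κ` for some permutations `ρ, κ` (no bicontraction step is possible, so the
  central subgraph is isomorphic, hence equal, to `K_{3,3}`).
-/

namespace Summit.ValiantsHypothesis.PolyaContinued

open Finset Literature.Combinatorics.SimpleGraph Equiv

/-! ### Vertex degrees and isomorphisms -/

section Degree

variable {m : ℕ}

open Classical in
/-- The degree of the row vertex `i`: its neighbours are the columns `j` with `(i, j) ∈ G`.
[folklore] -/
theorem card_filter_adj_inl (G : Finset (Fin m × Fin m)) (i : Fin m) :
    (Finset.univ.filter fun w : Fin m ⊕ Fin m => Adj G (Sum.inl i) w).card =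
      (G.filter fun e => e.1 = i).card := by
  rw [← Finset.card_image_of_injOn (s := G.filter fun e => e.1 = i)
    (f := fun e : Fin m × Fin m => (Sum.inr e.2 : Fin m ⊕ Fin m)) ?_]
  · congr 1
    ext w
    simp only [Finset.mem_filter, Finset.mem_univ, true_and, Finset.mem_image]
    constructor
    · intro hw
      rcases w with i' | j
      · simp at hw
      · rw [adj_inl_inr] at hw
        exact ⟨(i, j), ⟨hw, rfl⟩, rfl⟩
    · rintro ⟨e, ⟨he, hei⟩, rfl⟩
      rw [adj_inl_inr, ← hei]
      exact he
  · intro e he e' he' h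
    simp only [Finset.coe_filter, Set.mem_setOf_eq] at he he'
    have h2 : e.2 = e'.2 := Sum.inr_injective h
    exact Prod.ext (he.2.trans he'.2.symm) h2

open Classical in
/-- The degree of the column vertex `j`: its neighbours are the rows `i` with `(i, j) ∈ G`.
[folklore] -/
theorem card_filter_adj_inr (G : Finset (Fin m × Fin m)) (j : Fin m) :
    (Finset.univ.filter fun w : Fin m ⊕ Fin m => Adj G (Sum.inr j) w).card =
      (G.filter fun e => e.2 = j).card := by
  rw [← Finset.card_image_of_injOn (s := G.filter fun e => e.2 = j)
    (f := fun e : Fin m × Fin m => (Sum.inl e.1 : Fin m ⊕ Fin m)) ?_]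
  · congr 1
    ext w
    simp only [Finset.mem_filter, Finset.mem_univ, true_and, Finset.mem_image]
    constructor
    · intro hw
      rcases w with i | j'
      · rw [adj_inr_inl] at hw
        exact ⟨(i, j), ⟨hw, rfl⟩, rfl⟩
      · simp at hw
    · rintro ⟨e, ⟨he, hej⟩, rfl⟩
      rw [adj_inr_inl, ← hej]
      exact he
  · intro e he e' he' h
    simp only [Finset.coe_filter, Set.mem_setOf_eq] at he he'
    have h1 : e.1 = e'.1 := Sum.inl_injective h
    exact Prod.ext h1 (he.2.trans he'.2.symm)

open Classical in
/-- **Isomorphisms preserve degrees.** [folklore] -/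
theorem card_filter_adj_equiv {G G' : Finset (Fin m × Fin m)} {ψ : Fin m ⊕ Fin m ≃ Fin m ⊕ Fin m}
    (hψ : ∀ a b, Adj G a b ↔ Adj G' (ψ a) (ψ b)) (v : Fin m ⊕ Fin m) :
    (Finset.univ.filter fun w => Adj G' (ψ v) w).card =
      (Finset.univ.filter fun w => Adj G v w).card := by
  rw [← Finset.card_map (s := Finset.univ.filter fun w => Adj G v w) ψ.toEmbedding]
  congr 1
  ext w
  simp only [Finset.mem_map_equiv, Finset.mem_filter, Finset.mem_univ, true_and]
  rw [hψ v (ψ.symm w), ψ.apply_symm_apply]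

open Classical in
/-- **A bicontraction step needs a vertex of degree two**: if `BicontractionStep K K'` then some
row or some column of `K` has exactly two cells (the bicontracted vertex, pulled back along the
isomorphism to normal position). [folklore] -/
theorem exists_degree_two_of_bicontractionStep {K : Finset (Fin (m + 2) × Fin (m + 2))}
    {K' : Finset (Fin (m + 1) × Fin (m + 1))} (h : BicontractionStep K K') :
    (∃ i, (K.filter fun e => e.1 = i).card = 2) ∨ ∃ j, (K.filter fun e => e.2 = j).card = 2 := by
  obtain ⟨G₀, ⟨ψ, hψ⟩, hR, -⟩ := h
  -- row `0` of `G₀` has degree two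
  have h0 : (Finset.univ.filter fun w => Adj G₀ (Sum.inl 0) w).card = 2 := by
    rw [card_filter_adj_inl]
    unfold RowZeroBicontractible at hR
    rw [hR, Finset.card_pair]
    exact fun h => absurd (Prod.ext_iff.1 h).2 (by simp)
  -- pull back along `ψ`
  have key := card_filter_adj_equiv hψ (ψ.symm (Sum.inl 0))
  rw [ψ.apply_symm_apply, h0] at key
  rcases hv : ψ.symm (Sum.inl 0) with i | j
  · left
    refine ⟨i, ?_⟩
    rw [← card_filter_adj_inl, ← hv]
    exact key.symm
  · right
    refine ⟨j, ?_⟩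
    rw [← card_filter_adj_inr, ← hv]
    exact key.symm

/-- Every row of `K_{3,3}` has three cells. [folklore] -/
theorem card_filter_fst_univ_three (i : Fin 3) :
    ((Finset.univ : Finset (Fin 3 × Fin 3)).filter fun e => e.1 = i).card = 3 := by
  fin_cases i <;> rfl

/-- Every column of `K_{3,3}` has three cells. [folklore] -/
theorem card_filter_snd_univ_three (j : Fin 3) :
    ((Finset.univ : Finset (Fin 3 × Fin 3)).filter fun e => e.2 = j).card = 3 := by
  fin_cases j <;> rfl

open Classical in
/-- Every vertex of `K_{3,3}` has degree three. [folklore] -/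
theorem card_filter_adj_univ_three (v : Fin 3 ⊕ Fin 3) :
    (Finset.univ.filter fun w => Adj (Finset.univ : Finset (Fin 3 × Fin 3)) v w).card = 3 := by
  rcases v with i | j
  · rw [card_filter_adj_inl, card_filter_fst_univ_three]
  · rw [card_filter_adj_inr, card_filter_snd_univ_three]

open Classical in
/-- **A graph on `Fin 3 × Fin 3` isomorphic (as an abstract graph) to `K_{3,3}` is `K_{3,3}`**:
every row has degree three. [folklore] -/
theorem eq_univ_of_isIsomorphic_univ {K : Finset (Fin 3 × Fin 3)}
    (h : IsIsomorphic K (Finset.univ : Finset (Fin 3 × Fin 3))) : K = Finset.univ := by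
  obtain ⟨ψ, hψ⟩ := h
  have hrow : ∀ i : Fin 3, (K.filter fun e => e.1 = i).card = 3 := by
    intro i
    rw [← card_filter_adj_inl, ← card_filter_adj_equiv hψ (Sum.inl i), card_filter_adj_univ_three]
  have hcard : K.card = 9 := by
    rw [Finset.card_eq_sum_card_fiberwise (f := Prod.fst) (t := Finset.univ)
      (fun e _ => Finset.mem_univ _)]
    simp only [hrow, Finset.sum_const, Finset.card_univ, Fintype.card_fin, smul_eq_mul]
  exact Finset.eq_univ_of_card K (by rw [hcard]; simp)

end Degree

/-! ### The padded central subgraph of a deletion-minimal target -/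

variable {n : ℕ}

/-- **A deletion-minimal non-Pfaffian target is its own Little obstruction.** Let every
one-edge-deleted subgraph of `E` be Pfaffian, and let `K` (rows embedded by `r`, columns by `c`,
complementary perfect matching `τ`) be a central subgraph of `E` bicontracting to `K_{3,3}`.
Then every cell of `E` is a cell of the image of `K` or of the matching `τ`: the subgraph
`(r × c)(K) ∪ graph τ ⊆ E` has the `K_{3,3}` matching minor, so it is not Pfaffian
(`IsMatchingMinor.not_isPfaffianBipartite`), and deleting any further cell of `E` would keep it.
[folklore] -/
theorem eq_or_eq_of_erase_minimal {E : Finset (Fin n × Fin n)}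
    (hmin : ∀ e ∈ E, IsPfaffianBipartite (E.erase e)) {k : ℕ} {K : Finset (Fin k × Fin k)}
    (r c : Fin k ↪ Fin n) (hKE : ∀ e ∈ K, (r e.1, c e.2) ∈ E)
    (τ : {i : Fin n // i ∉ Set.range r} ≃ {j : Fin n // j ∉ Set.range c})
    (hτ : ∀ i : {i : Fin n // i ∉ Set.range r}, ((i : Fin n), ((τ i : {j // j ∉ Set.range c}) : Fin n)) ∈ E)
    (hB : Bicontracts K (Finset.univ : Finset (Fin 3 × Fin 3))) :
    ∀ e ∈ E, (∃ a b, (a, b) ∈ K ∧ e = (r a, c b)) ∨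
      ∃ i : {i : Fin n // i ∉ Set.range r}, e = ((i : Fin n), ((τ i : {j // j ∉ Set.range c}) : Fin n)) := by
  classical
  -- the padded central subgraph
  set E₁ := E.filter fun e => (∃ a b, (a, b) ∈ K ∧ e = (r a, c b)) ∨
      ∃ i : {i : Fin n // i ∉ Set.range r}, e = ((i : Fin n), ((τ i : {j // j ∉ Set.range c}) : Fin n))
    with hE₁
  have hcentral : IsCentralSubgraph K E₁ := by
    refine ⟨r, c, fun e he => ?_, τ, fun i => ?_⟩
    · exact Finset.mem_filter.2 ⟨hKE e he, Or.inl ⟨e.1, e.2, he, rfl⟩⟩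
    · exact Finset.mem_filter.2 ⟨hτ i, Or.inr ⟨i, rfl⟩⟩
  have hnot : ¬ IsPfaffianBipartite E₁ :=
    IsMatchingMinor.not_isPfaffianBipartite ⟨k, K, hcentral, hB⟩
  intro e he
  by_contra hne
  have hsub : E₁ ⊆ E.erase e := by
    intro x hx
    refine Finset.mem_erase.2 ⟨?_, (Finset.mem_filter.1 hx).1⟩
    rintro rfl
    exact hne (Finset.mem_filter.1 hx).2
  exact hnot ((hmin e he).anti hsub)

/-- In the padded central subgraph, the row `r a` has as many cells as the row `a` of `K`.
[folklore] -/
theorem card_filter_fst_pad {E : Finset (Fin n × Fin n)} {k : ℕ} {K : Finset (Fin k × Fin k)}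
    (r c : Fin k ↪ Fin n) (hKE : ∀ e ∈ K, (r e.1, c e.2) ∈ E)
    (τ : {i : Fin n // i ∉ Set.range r} ≃ {j : Fin n // j ∉ Set.range c})
    (hpad : ∀ e ∈ E, (∃ a b, (a, b) ∈ K ∧ e = (r a, c b)) ∨
      ∃ i : {i : Fin n // i ∉ Set.range r}, e = ((i : Fin n), ((τ i : {j // j ∉ Set.range c}) : Fin n)))
    (a : Fin k) :
    (E.filter fun e => e.1 = r a).card = (K.filter fun e => e.1 = a).card := by
  classical
  rw [← Finset.card_map ⟨fun e : Fin k × Fin k => (r e.1, c e.2), fun e e' h => by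
    obtain ⟨h1, h2⟩ := Prod.ext_iff.1 h; exact Prod.ext (r.injective h1) (c.injective h2)⟩]
  congr 1
  ext e
  simp only [Finset.mem_filter, Finset.mem_map, Function.Embedding.coeFn_mk]
  constructor
  · rintro ⟨he, hea⟩
    rcases hpad e he with ⟨a', b, hab, rfl⟩ | ⟨i, rfl⟩
    · have : a' = a := r.injective hea
      subst this
      exact ⟨(a', b), ⟨hab, rfl⟩, rfl⟩
    · exact absurd ⟨a, hea.symm⟩ i.2
  · rintro ⟨e', ⟨he', hea⟩, rfl⟩
    exact ⟨hKE e' he', by simp [hea]⟩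

/-- In the padded central subgraph, the column `c b` has as many cells as the column `b` of `K`.
[folklore] -/
theorem card_filter_snd_pad {E : Finset (Fin n × Fin n)} {k : ℕ} {K : Finset (Fin k × Fin k)}
    (r c : Fin k ↪ Fin n) (hKE : ∀ e ∈ K, (r e.1, c e.2) ∈ E)
    (τ : {i : Fin n // i ∉ Set.range r} ≃ {j : Fin n // j ∉ Set.range c})
    (hpad : ∀ e ∈ E, (∃ a b, (a, b) ∈ K ∧ e = (r a, c b)) ∨
      ∃ i : {i : Fin n // i ∉ Set.range r}, e = ((i : Fin n), ((τ i : {j // j ∉ Set.range c}) : Fin n)))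
    (b : Fin k) :
    (E.filter fun e => e.2 = c b).card = (K.filter fun e => e.2 = b).card := by
  classical
  rw [← Finset.card_map ⟨fun e : Fin k × Fin k => (r e.1, c e.2), fun e e' h => by
    obtain ⟨h1, h2⟩ := Prod.ext_iff.1 h; exact Prod.ext (r.injective h1) (c.injective h2)⟩]
  congr 1
  ext e
  simp only [Finset.mem_filter, Finset.mem_map, Function.Embedding.coeFn_mk]
  constructor
  · rintro ⟨he, heb⟩
    rcases hpad e he with ⟨a, b', hab, rfl⟩ | ⟨i, rfl⟩
    · have : b' = b := c.injective heb
      subst this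
      exact ⟨(a, b'), ⟨hab, rfl⟩, rfl⟩
    · exact absurd ⟨b, heb.symm⟩ (τ i).2
  · rintro ⟨e', ⟨he', heb⟩, rfl⟩
    exact ⟨hKE e' he', by simp [heb]⟩

/-! ### The standard target -/

/-- **`(r × c)(K_{3,3}) ∪ graph τ` is a relabelling of the standard target** `kstd n =
{(x, y) : x, y < 3} ∪ {(x, x) : 3 ≤ x}` (written as its defining filter): take `ρ` extending `r`
(`Equiv.Perm.exists_extending_pair`) and `κ` extending `c` by `κ x = τ (ρ x)` for `3 ≤ x`.
[folklore] -/
theorem exists_relabel_kstd {E : Finset (Fin n × Fin n)} (r c : Fin 3 ↪ Fin n)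
    (τ : {i : Fin n // i ∉ Set.range r} ≃ {j : Fin n // j ∉ Set.range c})
    (hE : ∀ e, e ∈ E ↔ (∃ a b, e = (r a, c b)) ∨
      ∃ i : {i : Fin n // i ∉ Set.range r}, e = ((i : Fin n), ((τ i : {j // j ∉ Set.range c}) : Fin n))) :
    ∃ ρ κ : Perm (Fin n), E = relabel (Finset.univ.filter fun e : Fin n × Fin n =>
      ((e.1 : ℕ) < 3 ∧ (e.2 : ℕ) < 3) ∨ (e.1 = e.2 ∧ 3 ≤ (e.1 : ℕ))) ρ κ := by
  classical
  have h3 : 3 ≤ n := by simpa using Fintype.card_le_of_embedding r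
  -- `ρ` extends `r`
  obtain ⟨ρ, hρ⟩ := Equiv.Perm.exists_extending_pair (fun a : Fin 3 => Fin.castLE h3 a) r
    (Fin.castLE_injective h3) r.injective
  have hρlt : ∀ x : Fin n, (hx : (x : ℕ) < 3) → ρ x = r ⟨x, hx⟩ := by
    intro x hx
    have := hρ ⟨x, hx⟩
    rwa [show Fin.castLE h3 ⟨x, hx⟩ = x from Fin.ext rfl] at this
  have hρge : ∀ x : Fin n, 3 ≤ (x : ℕ) → ρ x ∉ Set.range r := by
    rintro x hx ⟨a, ha⟩
    have : ρ (Fin.castLE h3 a) = ρ x := by rw [hρ a, ha]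
    have hxa := ρ.injective this
    have ha2 := a.2
    rw [← hxa, Fin.val_castLE] at hx
    omega
  -- `κ` extends `c` by `τ ∘ ρ`
  let κf : Fin n → Fin n := fun x =>
    if hx : (x : ℕ) < 3 then c ⟨x, hx⟩ else ((τ ⟨ρ x, hρge x (by omega)⟩ : {j // j ∉ Set.range c}) : Fin n)
  have hκlt : ∀ x : Fin n, (hx : (x : ℕ) < 3) → κf x = c ⟨x, hx⟩ := fun x hx => dif_pos hx
  have hκge : ∀ x : Fin n, (hx : 3 ≤ (x : ℕ)) →
      κf x = ((τ ⟨ρ x, hρge x hx⟩ : {j // j ∉ Set.range c}) : Fin n) := fun x hx =>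
    dif_neg (by omega)
  have hκinj : Function.Injective κf := by
    intro x y hxy
    by_cases hx : (x : ℕ) < 3 <;> by_cases hy : (y : ℕ) < 3
    · rw [hκlt x hx, hκlt y hy] at hxy
      have := c.injective hxy
      exact Fin.ext (by simpa using congrArg Fin.val this)
    · rw [hκlt x hx, hκge y (by omega)] at hxy
      exact absurd ⟨_, hxy⟩ (τ ⟨ρ y, _⟩).2
    · rw [hκge x (by omega), hκlt y hy] at hxy
      exact absurd ⟨_, hxy.symm⟩ (τ ⟨ρ x, _⟩).2
    · rw [hκge x (by omega), hκge y (by omega)] at hxy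
      have h1 := τ.injective (Subtype.ext hxy)
      exact ρ.injective (congrArg Subtype.val h1)
  let κ : Perm (Fin n) := Equiv.ofBijective κf (Finite.injective_iff_bijective.1 hκinj)
  have hκ : ∀ x, κ x = κf x := fun x => rfl
  refine ⟨ρ, κ, ?_⟩
  ext ⟨u, v⟩
  rw [relabel, Finset.mem_map_equiv, hE]
  simp only [Equiv.prodCongr_symm, Equiv.prodCongr_apply, Prod.map_apply, Finset.mem_filter,
    Finset.mem_univ, true_and]
  constructor
  · rintro (⟨a, b, h⟩ | ⟨i, h⟩)
    · obtain ⟨rfl, rfl⟩ := Prod.ext_iff.1 h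
      left
      have hρa : ρ.symm (r a) = Fin.castLE h3 a := by
        rw [Equiv.symm_apply_eq]; exact (hρ a).symm
      have hκb : κ.symm (c b) = Fin.castLE h3 b := by
        rw [Equiv.symm_apply_eq, hκ, hκlt _ (show ((Fin.castLE h3 b : Fin n) : ℕ) < 3 from b.2)]
        exact congrArg c (Fin.ext rfl)
      rw [hρa, hκb]
      exact ⟨a.2, b.2⟩
    · obtain ⟨rfl, rfl⟩ := Prod.ext_iff.1 h
      right
      set x := ρ.symm (i : Fin n) with hx
      have hρx : ρ x = i := by rw [hx, Equiv.apply_symm_apply]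
      have hxge : 3 ≤ (x : ℕ) := by
        by_contra hlt
        push Not at hlt
        exact i.2 ⟨⟨x, hlt⟩, by rw [← hρlt x hlt, hρx]⟩
      have hκx : κ x = ((τ i : {j // j ∉ Set.range c}) : Fin n) := by
        rw [hκ, hκge x hxge]
        have hi : (⟨ρ x, hρge x hxge⟩ : {i : Fin n // i ∉ Set.range r}) = i := Subtype.ext hρx
        rw [hi]
      have : κ.symm ((τ i : {j // j ∉ Set.range c}) : Fin n) = x := by
        rw [Equiv.symm_apply_eq]; exact hκx.symm
      rw [this]
      exact ⟨rfl, hxge⟩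
  · rintro (⟨hu, hv⟩ | ⟨huv, hge⟩)
    · left
      refine ⟨⟨(ρ.symm u : Fin n), hu⟩, ⟨(κ.symm v : Fin n), hv⟩, Prod.ext ?_ ?_⟩
      · show u = r ⟨(ρ.symm u : Fin n), hu⟩
        rw [← hρlt _ hu, Equiv.apply_symm_apply]
      · show v = c ⟨(κ.symm v : Fin n), hv⟩
        rw [← hκlt _ hv, ← hκ, Equiv.apply_symm_apply]
    · right
      refine ⟨⟨u, ?_⟩, Prod.ext rfl ?_⟩
      · rw [show u = ρ (ρ.symm u) from (Equiv.apply_symm_apply ρ u).symm]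
        exact hρge _ hge
      · show v = ((τ ⟨u, _⟩ : {j // j ∉ Set.range c}) : Fin n)
        have h1 : κ (κ.symm v) = v := Equiv.apply_symm_apply κ v
        rw [hκ, ← huv, hκge _ hge] at h1
        rw [← h1]
        exact congrArg (fun z => ((τ z : {j // j ∉ Set.range c}) : Fin n))
          (Subtype.ext (Equiv.apply_symm_apply ρ u))

/-! ### (SC5) The base case -/

/-- **(SC5) The base case of the target reduction.** Let `E ⊆ Fin n × Fin n` be non-Pfaffian with
every one-edge-deleted subgraph Pfaffian, and suppose no row and no column of `E` has exactly two
cells. Then `E = relabel (kstd n) ρ κ` for some permutations `ρ, κ` of `Fin n`, where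
`kstd n = {(x, y) : x, y < 3} ∪ {(x, x) : 3 ≤ x}` is the standard target (`K_{3,3}` plus the
diagonal). Proof: by Little's theorem (`Little1975_…_holds`) a central subgraph `K` of `E`
bicontracts to `K_{3,3}`; `E` is its padding (`eq_or_eq_of_erase_minimal`), so the rows/columns of
`K` have the degrees of their images in `E`; a bicontraction step would need a vertex of degree two
(`exists_degree_two_of_bicontractionStep`), so `K ≅ K_{3,3}`, hence `K = K_{3,3}`
(`eq_univ_of_isIsomorphic_univ`), and `exists_relabel_kstd` concludes. [folklore] -/
theorem exists_relabel_kstd_of_minimal {E : Finset (Fin n × Fin n)} (hE : ¬ IsPfaffianBipartite E)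
    (hmin : ∀ e ∈ E, IsPfaffianBipartite (E.erase e))
    (hrow : ∀ i, (E.filter fun e => e.1 = i).card ≠ 2)
    (hcol : ∀ j, (E.filter fun e => e.2 = j).card ≠ 2) :
    ∃ ρ κ : Perm (Fin n), E = relabel (Finset.univ.filter fun e : Fin n × Fin n =>
      ((e.1 : ℕ) < 3 ∧ (e.2 : ℕ) < 3) ∨ (e.1 = e.2 ∧ 3 ≤ (e.1 : ℕ))) ρ κ := by
  classical
  have hmm : IsMatchingMinor (Finset.univ : Finset (Fin 3 × Fin 3)) E := by
    by_contra h
    exact hE (Little1975_isPfaffianBipartite_iff_not_isMatchingMinor_holds.isPfaffianBipartite h)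
  obtain ⟨k, K, ⟨r, c, hKE, τ, hτ⟩, hB⟩ := hmm
  have hpad := eq_or_eq_of_erase_minimal hmin r c hKE τ hτ hB
  -- no bicontraction step is possible: `K ≅ K_{3,3}`
  cases hB with
  | step hstep _ =>
    exfalso
    rcases exists_degree_two_of_bicontractionStep hstep with ⟨i, hi⟩ | ⟨j, hj⟩
    · exact hrow (r i) ((card_filter_fst_pad r c hKE τ hpad i).trans hi)
    · exact hcol (c j) ((card_filter_snd_pad r c hKE τ hpad j).trans hj)
  | of_isIsomorphic hiso =>
    have hK : K = Finset.univ := eq_univ_of_isIsomorphic_univ hiso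
    subst hK
    refine exists_relabel_kstd r c τ fun e => ⟨fun he => ?_, fun he => ?_⟩
    · rcases hpad e he with ⟨a, b, -, h⟩ | ⟨i, h⟩
      · exact Or.inl ⟨a, b, h⟩
      · exact Or.inr ⟨i, h⟩
    · rcases he with ⟨a, b, rfl⟩ | ⟨i, rfl⟩
      · exact hKE (a, b) (Finset.mem_univ _)
      · exact hτ i

end Summit.ValiantsHypothesis.PolyaContinued
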